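import Literature.NumberTheory.GaloisRepresentations.ContinuousH1TrivialAction
import Literature.NumberTheory.GaloisRepresentations.GaloisCohomologyInfResProofs
import HarnessLib

/-!
# Sah's lemma for CONTINUOUS cohomology in degrees `0` and `1`, and the injectivity of
# restriction it yields via inflation–restriction (theorems only)

Topic `NumberTheory/GaloisRepresentations`; namespace `Literature.NumberTheory.GaloisRepresentations`.
THEOREMS ONLY (no definition, no named fact; D-0026), on the explicit continuous 1-cocycles of
`ContinuousH1.lean` (`contOneCocycles`, `oneCocycleClass`, `oneCocycleClass_surjective`,
`oneCocycleClass_eq_zero_iff`) and the tree's PROVED inflation–restriction sequence in degree one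
(`exact_inf_res_holds`, file `GaloisCohomologyInfResProofs.lean`).

**Sah's lemma** (Sah 1968, Prop. 2.7 (b) and its proof, p. 60). Let `G` be a group, `X` a
`G`-module and `z` a CENTRAL element of `G`. Then `z - 1` annihilates `H¹(G, X)`; in particular, if
`x ↦ z•x - x` is bijective on `X`, then `H⁰(G, X) = 0` and `H¹(G, X) = 0`.  The proof is the cocycle
identity `(z - 1)·φ(g) = (g - 1)·φ(z)` (expand `φ(zg) = φ(gz)`), valid verbatim for CONTINUOUS
cocycles of a topological group with values in a topological module — the generality proved here,
i.e. for Mathlib's `continuousCohomology 1 X` of a `TopRep R G`, which is the cohomology underlying the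
tree's `galoisCohomology ρ n` (discrete Galois modules) and `H1 T U` (`p`-adic representations).

RELATION TO THE TREE (cited, not restated): the same lemma for Mathlib's DISCRETE group cohomology
(`groupCohomology.IsCocycle₁` / `groupCohomology.H1`, abstract groups, no topology) is proved in
`Literature/NumberTheory/EllipticCurves/ComplexMultiplicationCoatesWilesSahProofs.lean`
(`smul_map_sub_map_eq_of_isCocycle₁`, `isCoboundary₁_smul_map_sub_map_of_mem_center`,
`H1π_eq_zero_of_mem_center_of_bijective`, `subsingleton_H1_of_mem_center_of_bijective`), serving
Coates–Wiles.  Mathlib's `groupCohomology` and `continuousCohomology` are different functors with no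
comparison map in the tree, and the Galois-cohomological consumers below live in the continuous one;
hence this sibling (same three-line argument, on `contOneCocycles`).

* `contOneCocycles.rho_sub_apply_of_mem_center` — the identity `z•φ(g) - φ(g) = g•φ(z) - φ(z)`;
* `contOneCocycles.exists_rho_sub_eq_of_mem_center` — ANNIHILATION FORM: the crossed homomorphism
  `g ↦ z•φ(g) - φ(g)` is principal (`= g•v - v` with `v = φ(z)`);
* `eq_zero_of_rho_eq_of_injective` — degree `0`: no non-zero `z`-invariant when `z - 1` is injective;
* `continuousCohomology_one_eq_zero_of_mem_center`, `subsingleton_continuousCohomology_one_of_mem_center`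
  — VANISHING FORM: `H¹_cont(G, X) = 0` when `z` is central and `x ↦ z•x - x` is bijective;
* `galoisCohomology.res_one_injective_of_mem_center` — with inflation–restriction (NSW (1.6.7),
  `exact_inf_res_holds`): for a discrete `Γ_K`-module `M`, a normal subextension `E/K` with
  `S = Gal(K̄/E)`, and `z ∈ Γ_K` central modulo `S` with `x ↦ z•x - x` bijective on `M^S`, the
  restriction `H¹(K, M) → H¹(E, M)` is INJECTIVE (its kernel `H¹(Gal(E/K), M^S)` vanishes by Sah).
  This is the shape in which "choose a non-trivial central homothety" arguments use the lemma
  (cell `bsd-smallim`, HOME/koly/MU-TRANSFER-PROOF.md (F8): `H¹(G_S, 𝒯_e) → Hom_G(G_{L₀}, 𝒯_e)`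
  injective; combine with `oneCocycleClass_injective_of_trivial` for `H¹(E, M) = Hom_cont(Γ_E, M)`
  when `Γ_E` acts trivially).

BSD / the summits are not advanced by this file: it is group-cohomology bookkeeping.

## References

* [Sah1968] C.-H. Sah, *Automorphisms of finite groups*, J. Algebra 10 (1968), 47–68 — Prop. 2.7 (b)
  and its proof, p. 60.
* [NeukirchSchmidtWingberg2008] J. Neukirch, A. Schmidt, K. Wingberg, *Cohomology of Number Fields*,
  2nd ed. (2008), (1.6.7) (inflation–restriction).
* [SerreGaloisCohomology1997] J.-P. Serre, *Galois Cohomology* (1997), I §2.6(b), I §5.1.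
-/

noncomputable section

open CategoryTheory Function

universe u v

namespace Literature.NumberTheory.GaloisRepresentations

open _root_.TopRep _root_.ContinuousCohomology _root_.Topology

/-! ## Sah's lemma for a topological representation -/

section Sah

variable {R : Type u} [Ring R] [TopologicalSpace R]
variable {G : Type v} [Group G] [TopologicalSpace G] [IsTopologicalGroup G]
variable (X : TopRep.{v} R G)

omit [IsTopologicalGroup G] in
variable {X} in
/-- **Sah's cocycle identity.** For a continuous crossed homomorphism `φ : G → X` and a CENTRAL
`z ∈ G`: `z•φ(g) - φ(g) = g•φ(z) - φ(z)` for every `g` (expand `φ(zg) = φ(gz)` both ways).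
[cite: Sah1968, Prop. 2.7 (b) and its proof, p. 60] -/
theorem contOneCocycles.rho_sub_apply_of_mem_center (φ : contOneCocycles X) {z : G}
    (hz : z ∈ Subgroup.center G) (g : G) :
    X.ρ z (φ.1 g) - φ.1 g = X.ρ g (φ.1 z) - φ.1 z := by
  have h1 := φ.2 z g
  have h2 := φ.2 g z
  rw [← Subgroup.mem_center_iff.mp hz g, h2] at h1
  -- h1 : φ g + ρ g (φ z) = φ z + ρ z (φ g)
  rw [sub_eq_sub_iff_add_eq_add, add_comm (X.ρ z (φ.1 g)), ← h1, add_comm]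

omit [IsTopologicalGroup G] in
variable {X} in
/-- **Sah's lemma, annihilation form** ("`z - 1` kills `H¹(G, X)`" on cocycles): for central `z`,
the crossed homomorphism `g ↦ z•φ(g) - φ(g)` is PRINCIPAL, namely `g ↦ g•v - v` with `v = φ(z)`.
[cite: Sah1968, Prop. 2.7 (b) and its proof, p. 60] -/
theorem contOneCocycles.exists_rho_sub_eq_of_mem_center (φ : contOneCocycles X) {z : G}
    (hz : z ∈ Subgroup.center G) :
    ∃ v : X, ∀ g, X.ρ z (φ.1 g) - φ.1 g = X.ρ g v - v :=
  ⟨φ.1 z, fun g => contOneCocycles.rho_sub_apply_of_mem_center φ hz g⟩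

omit [TopologicalSpace G] [IsTopologicalGroup G] in
variable {X} in
/-- **Sah's lemma in degree `0`.** If `x ↦ z•x - x` is injective on `X` (no centrality needed), the
only `G`-invariant — indeed the only `z`-invariant — element of `X` is `0`: `H⁰(G, X) = 0`.
[cite: Sah1968, Prop. 2.7 (b) and its proof, p. 60] -/
theorem eq_zero_of_rho_eq_of_injective {z : G} (hinj : Injective fun x : X => X.ρ z x - x)
    (x : X) (hx : X.ρ z x = x) : x = 0 := by
  apply hinj
  simp only [hx, sub_self, map_zero]

variable {X} in
/-- **Sah's lemma in degree `1` (vanishing form) for continuous cohomology.** Let `X` be a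
topological `R[G]`-module, `z ∈ G` central, and suppose `x ↦ z•x - x` is BIJECTIVE on `X`. Then
`H¹_cont(G, X) = 0`: every class of Mathlib's `continuousCohomology 1 X` vanishes.  Proof: a class is
`[φ]` for a continuous crossed homomorphism `φ` (`oneCocycleClass_surjective`); with `v` the unique
solution of `z•v - v = φ(z)`, Sah's identity and injectivity of `z - 1` give `φ(g) = g•v - v`, so
`[φ] = 0` (`oneCocycleClass_eq_zero_iff`).
[cite: Sah1968, Prop. 2.7 (b) and its proof, p. 60] -/
theorem continuousCohomology_one_eq_zero_of_mem_center {z : G} (hz : z ∈ Subgroup.center G)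
    (hbij : Bijective fun x : X => X.ρ z x - x) (c : continuousCohomology 1 X) : c = 0 := by
  obtain ⟨φ, rfl⟩ := oneCocycleClass_surjective X c
  rw [oneCocycleClass_eq_zero_iff]
  obtain ⟨v, hv⟩ := hbij.2 (φ.1 z)
  have hv' : X.ρ z v - v = φ.1 z := hv
  refine ⟨v, fun g => hbij.1 ?_⟩
  -- goal : ρ z (φ g) - φ g = ρ z (ρ g v - v) - (ρ g v - v)
  have hcomm : X.ρ z (X.ρ g v) = X.ρ g (X.ρ z v) :=
    calc X.ρ z (X.ρ g v) = (X.ρ z * X.ρ g) v := rfl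
      _ = X.ρ (g * z) v := by rw [← map_mul, Subgroup.mem_center_iff.mp hz g]
      _ = (X.ρ g * X.ρ z) v := by rw [map_mul]
      _ = X.ρ g (X.ρ z v) := rfl
  change X.ρ z (φ.1 g) - φ.1 g = X.ρ z (X.ρ g v - v) - (X.ρ g v - v)
  rw [contOneCocycles.rho_sub_apply_of_mem_center φ hz g, ← hv']
  simp only [map_sub]
  rw [hcomm]
  abel

variable {X} in
/-- Corollary: under the hypotheses of Sah's lemma `H¹_cont(G, X)` is a subsingleton.
[cite: Sah1968, Prop. 2.7 (b) and its proof, p. 60] -/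
theorem subsingleton_continuousCohomology_one_of_mem_center {z : G} (hz : z ∈ Subgroup.center G)
    (hbij : Bijective fun x : X => X.ρ z x - x) : Subsingleton (continuousCohomology 1 X) :=
  ⟨fun a b => by
    rw [continuousCohomology_one_eq_zero_of_mem_center hz hbij a,
      continuousCohomology_one_eq_zero_of_mem_center hz hbij b]⟩

end Sah

/-! ## The Galois-cohomology consequence: restriction is injective in degree one -/

section Galois

variable {K : Type u} [Field K] {M : Type u} [AddCommGroup M] [TopologicalSpace M]
  [DiscreteTopology M]

/-- **Restriction `H¹(K, M) → H¹(E, M)` is injective when a central element of `Gal(E/K)` acts on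
`M^{Gal(K̄/E)}` with `z - 1` bijective** (Sah's lemma + inflation–restriction).  Here `E/K` is a
normal subextension of `K̄/K`, `S = absGaloisFixingSubgroup E = Gal(K̄/E)`, `z ∈ Γ_K` has CENTRAL
image in `Γ_K ⧸ S = Gal(E/K)`, and `x ↦ z•x - x` is bijective on the invariants `M^S`; the kernel of
`res` is the image of inflation from `H¹(Γ_K ⧸ S, M^S)` (`exact_inf_res_holds`), which vanishes by
`continuousCohomology_one_eq_zero_of_mem_center`.  Typical use ("choose a non-trivial central
homothety"; cell `bsd-smallim` (F8)): `M` a finite `𝔽_p[Γ_K]`-module on which `S` acts trivially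
(so `M^S = M` and `H¹(E, M) = Hom_cont(Γ_E, M)`, `oneCocycleClass_injective_of_trivial`) and `z`
acting on `M` by a scalar `λ ≠ 1`.
[cite: Sah1968, Prop. 2.7 (b) and its proof, p. 60; NeukirchSchmidtWingberg2008, (1.6.7)] -/
theorem galoisCohomology.res_one_injective_of_mem_center (ρ : DiscreteGaloisModule K M)
    (E : IntermediateField K (AlgebraicClosure K)) [Normal K E] {z : Field.absoluteGaloisGroup K}
    (hz : (z : Field.absoluteGaloisGroup K ⧸ absGaloisFixingSubgroup E) ∈
      Subgroup.center (Field.absoluteGaloisGroup K ⧸ absGaloisFixingSubgroup E))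
    (hbij : Bijective fun x : Representation.invariants
        (ρ.toRepresentation.comp (absGaloisFixingSubgroup E).subtype) =>
      ρ.quotientInvariants (absGaloisFixingSubgroup E) (z : _ ⧸ absGaloisFixingSubgroup E) x - x) :
    Injective (galoisCohomology.res ρ E 1) := by
  have hex := exact_inf_res_holds K M ρ E
  refine (injective_iff_map_eq_zero _).mpr fun x hx => ?_
  obtain ⟨y, rfl⟩ := (hex x).mp hx
  rw [continuousCohomology_one_eq_zero_of_mem_center
    (X := (ρ.quotientInvariants (absGaloisFixingSubgroup E)).toTopRep) hz hbij y, map_zero]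

end Galois

end Literature.NumberTheory.GaloisRepresentations
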